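import Mathlib
import Summits.ValiantsHypothesis.ValiantsHypothesis.Theses.NewtonUnitEquations

/-!
# `DissociatedFixedK` (stmt-ValiantsHypothesis-5907) — load-bearing hypotheses (negative lane, part 1)

Negative knowledge for the crux
`Summit.ValiantsHypothesis.ValiantsHypothesis.Theses.NewtonUnitEquations.DissociatedFixedK`
(route NewtonUnitEquations), from the standing disprover's `Cruxes/DissociatedFixedK/Disproof.lean`
§B0/§B/§C (the crux itself is believed TRUE with `C = O(k)`; see that file's blueprint):

* `dissociatedFixedK_false_without_card` — with `∀ j, #A j ≤ t` deleted the statement is FALSE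
  (`k = m = 1`, `t = 0`, one polynomial with `2^C + 1` monomials on a convex lattice chain);
* `dissociatedFixedK_false_without_supp` — with `supp f i j ⊆ A j` deleted it is FALSE (`A j = ∅`);
* (in the sequel file `UniformCFalse.lean`) `not_dissociatedFixedKUniformC` — the strengthening
  `∃ C, ∀ k` is FALSE (KPTT arXiv:1308.2286 Example 3 digit grids; `C(k) → ∞` is forced).
* On the way (reusable by provers of the crux): `mem_extremePoints_convexHull_of_strict_sep` (strict
  exposure by a linear functional ⇒ extreme point of the convex hull), `extremePoints_chain`,
  `support_chainPoly`, `vertices_chainPoly` (stated with the crux's literal embedding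
  `fun e i => ((e i : ℕ) : ℝ)`).
The third hypothesis (dissociation) is NOT shown load-bearing here: the crux without it contains a
polynomial-in-`mt` form of the open sibling crux `TwoProducts` (KPTT §5); it is recorded as the `def`
`DissociatedFixedKWithoutDissoc` only.  [folklore]
-/

namespace Summit.ValiantsHypothesis.ValiantsHypothesis.Theorems.DissociatedFixedK.Negative

open Finset

/-! ## Witness machinery: strict exposure, the convex lattice chain, `chainPoly` -/

/-- Strict exposure by a linear functional makes a point of `S` an extreme point of `conv S`:
if `l y < l x` for every `y ∈ S \ {x}` then `x ∈ extremePoints (convexHull S)`.  [folklore] -/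
theorem mem_extremePoints_convexHull_of_strict_sep {E : Type*} [AddCommGroup E] [Module ℝ E]
    {S : Set E} {x : E} (hx : x ∈ S) (l : E →ₗ[ℝ] ℝ) (hl : ∀ y ∈ S, y ≠ x → l y < l x) :
    x ∈ Set.extremePoints ℝ (convexHull ℝ S) := by
  -- the convex set `B = {x} ∪ {l < l x}` contains `S`, hence `conv S`
  set B : Set E := {y | y = x ∨ l y < l x} with hB
  have hBconv : Convex ℝ B := by
    intro y₁ hy₁ y₂ hy₂ a b ha hb hab
    have hval : l (a • y₁ + b • y₂) = a * l y₁ + b * l y₂ := by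
      simp [map_add, map_smul, smul_eq_mul]
    by_cases ha0 : a = 0
    · subst ha0
      simp only [zero_add] at hab
      subst hab
      simpa using hy₂
    by_cases hb0 : b = 0
    · subst hb0
      simp only [add_zero] at hab
      subst hab
      simpa using hy₁
    have hapos : 0 < a := lt_of_le_of_ne ha (Ne.symm ha0)
    have hbpos : 0 < b := lt_of_le_of_ne hb (Ne.symm hb0)
    have h1 : l y₁ ≤ l x := by
      rcases hy₁ with h | h
      · rw [h]
      · exact h.le
    have h2 : l y₂ ≤ l x := by
      rcases hy₂ with h | h
      · rw [h]
      · exact h.le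
    rcases hy₁ with rfl | hy₁
    · rcases hy₂ with rfl | hy₂
      · left
        rw [← add_smul, hab, one_smul]
      · right
        rw [hval]
        have e1 : a * l y₁ + b * l y₁ = l y₁ := by rw [← add_mul, hab, one_mul]
        have e2 : b * l y₂ < b * l y₁ := mul_lt_mul_of_pos_left hy₂ hbpos
        linarith
    · right
      rw [hval]
      have e1 : a * l x + b * l x = l x := by rw [← add_mul, hab, one_mul]
      have e2 : a * l y₁ < a * l x := mul_lt_mul_of_pos_left hy₁ hapos
      have e3 : b * l y₂ ≤ b * l x := mul_le_mul_of_nonneg_left h2 hb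
      linarith
  have hSB : S ⊆ B := by
    intro y hy
    by_cases h : y = x
    · exact Or.inl h
    · exact Or.inr (hl y hy h)
  have hconvB : convexHull ℝ S ⊆ B := convexHull_min hSB hBconv
  rw [mem_extremePoints]
  refine ⟨subset_convexHull ℝ S hx, ?_⟩
  intro x₁ hx₁ x₂ hx₂ hxseg
  obtain ⟨a, b, ha, hb, hab, hcomb⟩ := hxseg
  have key : l x = a * l x₁ + b * l x₂ := by
    rw [← hcomb]; simp [map_add, map_smul, smul_eq_mul]
  have h1 := hconvB hx₁
  have h2 := hconvB hx₂
  have hl1 : l x₁ ≤ l x := by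
    rcases h1 with h | h
    · rw [h]
    · exact h.le
  have hl2 : l x₂ ≤ l x := by
    rcases h2 with h | h
    · rw [h]
    · exact h.le
  have e1 : a * l x + b * l x = l x := by rw [← add_mul, hab, one_mul]
  constructor
  · rcases h1 with h | h
    · exact h
    · exfalso
      have e2 : a * l x₁ < a * l x := mul_lt_mul_of_pos_left h ha
      have e3 : b * l x₂ ≤ b * l x := mul_le_mul_of_nonneg_left hl2 hb.le
      linarith
  · rcases h2 with h | h
    · exact h
    · exfalso
      have e2 : b * l x₂ < b * l x := mul_lt_mul_of_pos_left h hb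
      have e3 : a * l x₁ ≤ a * l x := mul_le_mul_of_nonneg_left hl1 ha.le
      linarith

/-- If every point of `S` is strictly exposed then `extremePoints (conv S) = S`. [folklore] -/
theorem extremePoints_convexHull_eq_of_strict_sep {E : Type*} [AddCommGroup E] [Module ℝ E]
    {S : Set E} (h : ∀ x ∈ S, ∃ l : E →ₗ[ℝ] ℝ, ∀ y ∈ S, y ≠ x → l y < l x) :
    Set.extremePoints ℝ (convexHull ℝ S) = S := by
  apply Set.Subset.antisymm extremePoints_convexHull_subset
  intro x hx
  obtain ⟨l, hl⟩ := h x hx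
  exact mem_extremePoints_convexHull_of_strict_sep hx l hl

/-- The embedding `ℕ²`-exponents ↦ `ℝ²` used by the route (literal subterm of the crux). -/
noncomputable def emb (e : Fin 2 →₀ ℕ) : Fin 2 → ℝ := fun i => ((e i : ℕ) : ℝ)

/-- The embedding `ℕ² ↪ ℝ²` is injective. -/
theorem emb_injective : Function.Injective emb := by
  intro e e' h
  ext i
  have := congrFun h i
  simpa [emb] using this

/-- A convex lattice chain: the points `(g n, n)` where `g` has strictly increasing increments
(`g (n+1) - g n < g (n+2) - g (n+1)`, e.g. `g n = n²` or `n(n-1)/2`) are in strictly convex position: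
`(n, g n)`-type parabola points are strictly exposed by `l(X, Y) = (2n) ... `.  We use the concrete
chain `q n = (n(n-1)/2, n)` of KPTT Lemma 2 and expose `q n` by `l(X,Y) = (2n-1)·Y - 2·X`:
`l(q m) - l(q n) = -(m-n)²`. -/
noncomputable def chainPt (n : ℕ) : Fin 2 →₀ ℕ :=
  Finsupp.single 0 (n * (n - 1) / 2) + Finsupp.single 1 n

/-- First coordinate of the chain point: `n(n-1)/2`. -/
theorem chainPt_zero_apply (n : ℕ) : chainPt n 0 = n * (n - 1) / 2 := by
  simp [chainPt]

/-- Second coordinate of the chain point: `n`. -/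
theorem chainPt_one_apply (n : ℕ) : chainPt n 1 = n := by
  simp [chainPt]

/-- Distinct indices give distinct chain points (read off the second coordinate). -/
theorem chainPt_injective : Function.Injective chainPt := by
  intro n n' h
  have := congrArg (fun e => e 1) h
  simpa [chainPt_one_apply] using this

/-- `2 · (n(n-1)/2) = n(n-1)` over `ℕ` (the product of two consecutive naturals is even). -/
theorem two_mul_chainX (n : ℕ) : 2 * (n * (n - 1) / 2) = n * (n - 1) := by
  have : Even (n * (n - 1)) := Nat.even_mul_pred_self n
  obtain ⟨r, hr⟩ := this
  omega

/-- The exposing functional for `chainPt n`: `l(X, Y) = (2n-1)·Y - 2·X` on `Fin 2 → ℝ`. -/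
noncomputable def chainExp (n : ℕ) : (Fin 2 → ℝ) →ₗ[ℝ] ℝ :=
  (2 * (n : ℝ) - 1) • LinearMap.proj 1 - (2 : ℝ) • LinearMap.proj 0

/-- Evaluation of the exposing functional. -/
theorem chainExp_apply (n : ℕ) (v : Fin 2 → ℝ) :
    chainExp n v = (2 * (n : ℝ) - 1) * v 1 - 2 * v 0 := by
  simp [chainExp, smul_eq_mul]

/-- `l_n(q_m) = (2n-1)m - m(m-1)` (real form of the lattice computation). -/
theorem chainExp_emb_chainPt (n m : ℕ) :
    chainExp n (emb (chainPt m)) = (2 * (n : ℝ) - 1) * m - (m : ℝ) * ((m : ℝ) - 1) := by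
  rw [chainExp_apply]
  simp only [emb, chainPt_zero_apply, chainPt_one_apply]
  have h := two_mul_chainX m
  have hcast : (2 : ℝ) * ((m * (m - 1) / 2 : ℕ) : ℝ) = (m : ℝ) * ((m : ℝ) - 1) := by
    rcases Nat.eq_zero_or_pos m with hm | hm
    · subst hm; simp
    · have h2 : ((2 * (m * (m - 1) / 2) : ℕ) : ℝ) = ((m * (m - 1) : ℕ) : ℝ) := by rw [h]
      rw [Nat.cast_mul, Nat.cast_mul, Nat.cast_pred hm] at h2
      exact_mod_cast h2
  linarith

/-- Strict exposure: `l_n(q_m) < l_n(q_n)` for `m ≠ n`, since the difference is `-(m-n)²`. -/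
theorem chainExp_strict (n m : ℕ) (hmn : m ≠ n) :
    chainExp n (emb (chainPt m)) < chainExp n (emb (chainPt n)) := by
  rw [chainExp_emb_chainPt, chainExp_emb_chainPt]
  have : ((m : ℝ) - n) ^ 2 > 0 := by
    have : (m : ℝ) - n ≠ 0 := sub_ne_zero.mpr (by exact_mod_cast hmn)
    positivity
  nlinarith

/-- The chain points are in strictly convex position: for any set `F` of indices,
`extremePoints (conv (emb '' chainPt '' F)) = emb '' chainPt '' F`. -/
theorem extremePoints_chain (F : Set ℕ) :
    Set.extremePoints ℝ (convexHull ℝ (emb '' (chainPt '' F))) = emb '' (chainPt '' F) := by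
  apply extremePoints_convexHull_eq_of_strict_sep
  rintro x ⟨e, ⟨n, hn, rfl⟩, rfl⟩
  refine ⟨chainExp n, ?_⟩
  rintro y ⟨e', ⟨m, hm, rfl⟩, rfl⟩ hne
  apply chainExp_strict
  rintro rfl
  exact hne rfl

/-- Counting the embedded chain points. -/
theorem ncard_emb_chain (F : Finset ℕ) :
    (emb '' (chainPt '' (F : Set ℕ))).ncard = F.card := by
  rw [Set.ncard_image_of_injective _ emb_injective, Set.ncard_image_of_injective _ chainPt_injective,
    Set.ncard_coe_finset]

/-! ## §B  Load-bearing analysis of the three hypotheses -/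

open MvPolynomial in
/-- The crux with the cardinality hypothesis `∀ j, #A j ≤ t` DELETED (so `t` is a free parameter that
no longer controls anything). -/
def DissociatedFixedKWithoutCard : Prop :=
  ∀ k : ℕ, ∃ C : ℕ, ∀ (m t : ℕ) (A : Fin m → Finset (Fin 2 →₀ ℕ))
    (f : Fin k → Fin m → MvPolynomial (Fin 2) ℂ),
    (∀ i j, (f i j).support ⊆ A j) →
    (∀ a b : Fin m → (Fin 2 →₀ ℕ), (∀ j, a j ∈ A j) → (∀ j, b j ∈ A j) → ∑ j, a j = ∑ j, b j → a = b) →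
    (Set.extremePoints ℝ (convexHull ℝ ((fun e : Fin 2 →₀ ℕ => fun i : Fin 2 => ((e i : ℕ) : ℝ)) ''
      ((∑ i, ∏ j, f i j).support : Set (Fin 2 →₀ ℕ))))).ncard ≤ (m * t + 2) ^ C

/-- The crux with the support hypothesis `∀ i j, supp f i j ⊆ A j` DELETED (so `A`, `t` and the
dissociation hypothesis no longer talk about `f`). -/
def DissociatedFixedKWithoutSupp : Prop :=
  ∀ k : ℕ, ∃ C : ℕ, ∀ (m t : ℕ) (A : Fin m → Finset (Fin 2 →₀ ℕ))
    (f : Fin k → Fin m → MvPolynomial (Fin 2) ℂ),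
    (∀ j, (A j).card ≤ t) →
    (∀ a b : Fin m → (Fin 2 →₀ ℕ), (∀ j, a j ∈ A j) → (∀ j, b j ∈ A j) → ∑ j, a j = ∑ j, b j → a = b) →
    (Set.extremePoints ℝ (convexHull ℝ ((fun e : Fin 2 →₀ ℕ => fun i : Fin 2 => ((e i : ℕ) : ℝ)) ''
      ((∑ i, ∏ j, f i j).support : Set (Fin 2 →₀ ℕ))))).ncard ≤ (m * t + 2) ^ C

/-- The crux with DISSOCIATION (injectivity of the sum map on `Π_j A j`) DELETED.  Status: OPEN.
True for `k ≤ 1` (no cancellation: Newton polygon of a product is the Minkowski sum, ≤ `m t` vertices);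
for `k = 2` it asserts `#vert Newt(Π_j f_j + Π_j g_j) ≤ (mt+2)^C` for `t`-sparse factors — a
polynomial-in-`mt` strengthening of the sibling crux `TwoProducts` (which allows `2^{am}`), containing
KPTT's §5 open problems (`fg + 1`, `f₁⋯f_m + 1`).  No counterexample is known or was found; a
refutation would need `2^{Ω(m)}` hull vertices carved by TWO products out of a coinciding (non-injective)
grid — impossible in the injective regime by the crux itself. -/
def DissociatedFixedKWithoutDissoc : Prop :=
  ∀ k : ℕ, ∃ C : ℕ, ∀ (m t : ℕ) (A : Fin m → Finset (Fin 2 →₀ ℕ))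
    (f : Fin k → Fin m → MvPolynomial (Fin 2) ℂ),
    (∀ j, (A j).card ≤ t) → (∀ i j, (f i j).support ⊆ A j) →
    (Set.extremePoints ℝ (convexHull ℝ ((fun e : Fin 2 →₀ ℕ => fun i : Fin 2 => ((e i : ℕ) : ℝ)) ''
      ((∑ i, ∏ j, f i j).support : Set (Fin 2 →₀ ℕ))))).ncard ≤ (m * t + 2) ^ C


/-! ### The witness polynomial: one monomial per chain point -/

open MvPolynomial

/-- `chainPoly F = Σ_{n ∈ F} X^{n(n-1)/2} Y^n` (coefficients `1`). -/
noncomputable def chainPoly (F : Finset ℕ) : MvPolynomial (Fin 2) ℂ :=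
  ∑ n ∈ F, monomial (chainPt n) 1

/-- Coefficient of `chainPoly F` at a chain point. -/
theorem coeff_chainPoly_chainPt (F : Finset ℕ) (n : ℕ) :
    coeff (chainPt n) (chainPoly F) = if n ∈ F then 1 else 0 := by
  simp only [chainPoly, coeff_sum, coeff_monomial]
  have : ∀ n' ∈ F, (if chainPt n' = chainPt n then (1 : ℂ) else 0) = if n = n' then 1 else 0 := by
    intro n' _
    rcases eq_or_ne n n' with h | h
    · subst h; simp
    · have : chainPt n' ≠ chainPt n := fun h' => h (chainPt_injective h').symm
      simp [this, h]
  rw [Finset.sum_congr rfl this, Finset.sum_ite_eq]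

/-- The support of `chainPoly F` is exactly the set of chain points indexed by `F`. -/
theorem support_chainPoly (F : Finset ℕ) : (chainPoly F).support = F.image chainPt := by
  apply Finset.Subset.antisymm
  · intro d hd
    have := support_sum (s := F) (f := fun n => monomial (chainPt n) (1 : ℂ)) hd
    simp only [Finset.mem_biUnion] at this
    obtain ⟨n, hn, hdn⟩ := this
    have := support_monomial_subset hdn
    simp only [Finset.mem_singleton] at this
    exact Finset.mem_image.mpr ⟨n, hn, this.symm⟩
  · intro d hd
    obtain ⟨n, hn, rfl⟩ := Finset.mem_image.mp hd
    rw [mem_support_iff, coeff_chainPoly_chainPt]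
    simp [hn]

/-- `chainPoly F` has exactly `#F` Newton-polygon vertices (crux's literal vertex count). -/
theorem vertices_chainPoly (F : Finset ℕ) :
    (Set.extremePoints ℝ (convexHull ℝ ((fun e : Fin 2 →₀ ℕ => fun i : Fin 2 => ((e i : ℕ) : ℝ)) ''
      ((chainPoly F).support : Set (Fin 2 →₀ ℕ))))).ncard = F.card := by
  rw [show (fun e : Fin 2 →₀ ℕ => fun i : Fin 2 => ((e i : ℕ) : ℝ)) = emb from rfl,
    support_chainPoly, Finset.coe_image, extremePoints_chain, ncard_emb_chain]

/-- A `Fin 1 × Fin 1` sum of products is its single entry. -/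
theorem sum_prod_fin_one (g : Fin 1 → Fin 1 → MvPolynomial (Fin 2) ℂ) :
    (∑ i : Fin 1, ∏ j : Fin 1, g i j) = g 0 0 := by
  simp

/-! ### §B theorems: the two bookkeeping hypotheses are (formally) load-bearing -/

/-- With `#A j ≤ t` deleted the crux is FALSE: at `k = 1`, `m = 1`, `t = 0` the bound is the constant
`2^C`, but `A 0 = ` `2^C + 1` chain points and `f 0 0 = chainPoly` has `2^C + 1` vertices.  So the proof
must use `#A j ≤ t` — of course only as bookkeeping (`t` is what the bound is measured in). -/
theorem dissociatedFixedK_false_without_card : ¬ DissociatedFixedKWithoutCard := by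
  intro h
  obtain ⟨C, hC⟩ := h 1
  have hle := hC 1 0 (fun _ => (Finset.range (2 ^ C + 1)).image chainPt)
    (fun _ _ => chainPoly (Finset.range (2 ^ C + 1)))
    (fun _ _ => by rw [support_chainPoly])
    (fun a b ha hb hab => by
      funext j
      fin_cases j
      simpa using hab)
  rw [sum_prod_fin_one, vertices_chainPoly, Finset.card_range] at hle
  simp at hle

/-- With `supp f i j ⊆ A j` deleted the crux is FALSE: take `A j = ∅` (so `t = 0` and dissociation is
vacuous) and the same `f`.  So the proof must use the support hypothesis (bookkeeping again). -/
theorem dissociatedFixedK_false_without_supp : ¬ DissociatedFixedKWithoutSupp := by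
  intro h
  obtain ⟨C, hC⟩ := h 1
  have hle := hC 1 0 (fun _ => ∅) (fun _ _ => chainPoly (Finset.range (2 ^ C + 1)))
    (fun _ => by simp)
    (fun a b ha _ _ => by simpa using ha 0)
  rw [sum_prod_fin_one, vertices_chainPoly, Finset.card_range] at hle
  simp at hle


end Summit.ValiantsHypothesis.ValiantsHypothesis.Theorems.DissociatedFixedK.Negative
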